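import Summits.AtomisticToContinuum.FouriersLaw.Theses.LocalOhmBV
import Literature.MathematicalPhysics.KineticTheory.LangevinChainGibbs
import Summits.AtomisticToContinuum.FouriersLaw.Theorems.BondHeatUncertaintyLinearResponseFTURNessFacts
import Summits.AtomisticToContinuum.FouriersLaw.Theorems.BondHeatUncertaintyLinearResponseFTURSteadyHeatRatesHelper1
import Summits.AtomisticToContinuum.FouriersLaw.Theorems.ParityLiouvilleSeedWindowLimitCurrents
import Summits.AtomisticToContinuum.FouriersLaw.Theorems.OddSectorIrreversibilityCorrectorTheorySiteEnergy
import Summits.AtomisticToContinuum.FouriersLaw.Theorems.IncoherentChannel.Negative.KernelMoments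

/-!
# Finite-`N` steady states of the pinned chain: Gibbs at equal temperatures, polynomial moments,
# equal mean bond currents on ALL genuine bonds

Helper file for stub `stub_finiteResponsePackage` (S2a, the finite-`N` non-equilibrium package of the
extraction step) of the birth line of crux `LocalOhmBV.LocalOhm` (item stmt-AtomisticToContinuum-12009),
clauses (a1) and (a4):

* `steadyFamily_eq_gibbsMeasure` — (a1): under weak-NESS uniqueness the steady state at equal bath
  temperatures is the Gibbs state (`pinnedChain_isSteadyState_gibbsMeasure`);
* `one_add_norm_pow_le_exp_hamiltonian`, `integrable_one_add_norm_pow_of_exp` — polynomial weights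
  `(1 + ‖x‖)^K` are dominated by `e^{ϑH}` (coercivity `‖x‖² ≤ 2 max(ω₂⁻¹, 1) H`), hence integrable under
  one exponential moment; `pinnedChain_hamiltonian_le_pow` — `H ≤ C_N (1 + ‖x‖)⁴`;
* `integral_bondCurrent_eq_succ_of_isSteadyState` — for EVERY `1 ≤ m ≤ N - 2`, `∫ j_{m-1} dμ = ∫ j_m dμ`
  in a weak steady state with polynomial moments: weak stationarity
  (`WindowLimit.integral_generator_eq_zero_of_polyGrowth`) tested on the finite-chain SITE ENERGY `h_m`,
  which does not depend on the bath momenta, with the local energy balance `X_H h_m = j_{m-1} - j_m`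
  (`Corrector.liouvilleOp_siteEnergy`) — this covers the two boundary bonds `j_0 = j_1`,
  `j_{N-3} = j_{N-2}` that `WindowLimit.pinnedChain_integral_bondCurrent_succ_eq` (infinite-chain
  energy density read in the bulk) leaves out;
* `integral_bondCurrent_eq_of_isSteadyState`, `steadyFamily_integral_bondCurrent_eq` — (a4): all genuine
  bond currents (`i + 2 ≤ N`) have the same mean, along a steady-state family under uniqueness
  (moments from `BondHeatUncertainty.ness_facts`).

No definitions.
-/

set_option autoImplicit false

noncomputable section

namespace Summit.AtomisticToContinuum.FouriersLaw.Theorems.LocalOhmBirth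

open MeasureTheory Filter Topology
open scoped BigOperators ContDiff
open Literature.MathematicalPhysics.KineticTheory.HeatConduction
open Summit.AtomisticToContinuum.FouriersLaw.Theorems.WindowLimit (abs_coord_le_norm
  integral_generator_eq_zero_of_polyGrowth pinnedChain_abs_partialQ_hamiltonian_le
  pinnedChain_abs_bondCurrent_le_pow)
open Summit.AtomisticToContinuum.FouriersLaw.Theorems.IncoherentChannel.Negative.KernelMoments
  (norm_sq_le_mul_hamiltonian)
open Summit.AtomisticToContinuum.FouriersLaw.Theorems.LinearResponseFTUR (one_add_pow_le_mul_exp)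
open Summit.AtomisticToContinuum.FouriersLaw.Theorems.OddSectorIrreversibility.Corrector
  (liouvilleOp_siteEnergy partialP_siteEnergy_of_ne siteEnergy_nonneg siteEnergy_le_hamiltonian)
open Summit.AtomisticToContinuum.FouriersLaw.Theorems.SuperadditiveResistance.DeviceLiouville (liouvilleOp)

variable {N : ℕ}

/-! ## (a1) The steady state at equal temperatures is the Gibbs state -/

/-- **(a1)**: under uniqueness of the weak steady states at `(N, T, T)`, a weak steady state of the
pinned chain (`ω₂ > 0`, `lam, β ≥ 0`, `T > 0`) IS the Gibbs state `gibbsMeasure N T`. [folklore] -/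
theorem steadyFamily_eq_gibbsMeasure {ω₂ lam β γ : ℝ} (hω : 0 < ω₂) (hl : 0 ≤ lam) (hβ : 0 ≤ β)
    {T : ℝ} (hT : 0 < T)
    (hU : ∀ μ ν : Measure (PhaseSpace N), (pinnedChain ω₂ lam β γ).IsSteadyState N T T μ →
      (pinnedChain ω₂ lam β γ).IsSteadyState N T T ν → μ = ν)
    {μ : Measure (PhaseSpace N)} (hμ : (pinnedChain ω₂ lam β γ).IsSteadyState N T T μ) :
    μ = (pinnedChain ω₂ lam β γ).gibbsMeasure N T :=
  hU _ _ hμ (pinnedChain_isSteadyState_gibbsMeasure hω hl hβ γ N hT)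

/-! ## Polynomial weights against the energy -/

/-- `1 + ‖x‖ ≤ max 2 (2 max(ω₂⁻¹, 1)) · (1 + H(x))` (coercivity of the pinned-chain energy in the sup
norm). [folklore] -/
theorem one_add_norm_le_mul_one_add_hamiltonian {ω₂ lam β : ℝ} (hω : 0 < ω₂) (hl : 0 ≤ lam)
    (hβ : 0 ≤ β) (γ : ℝ) (x : PhaseSpace N) :
    1 + ‖x‖ ≤ max 2 (2 * max ω₂⁻¹ 1) * (1 + (pinnedChain ω₂ lam β γ).hamiltonian N x) := by
  have hH := pinnedChain_hamiltonian_nonneg hω.le hl hβ γ N x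
  have hsq := norm_sq_le_mul_hamiltonian hω hl hβ γ x
  set c : ℝ := 2 * max ω₂⁻¹ 1 with hc
  have hc0 : 0 ≤ c := by positivity
  have h1 : ‖x‖ ≤ 1 + ‖x‖ ^ 2 := by nlinarith [norm_nonneg x, sq_nonneg (‖x‖ - 1)]
  have h2 : (2 : ℝ) ≤ max 2 c := le_max_left _ _
  have h3 : c * (pinnedChain ω₂ lam β γ).hamiltonian N x ≤
      max 2 c * (pinnedChain ω₂ lam β γ).hamiltonian N x :=
    mul_le_mul_of_nonneg_right (le_max_right _ _) hH
  nlinarith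

/-- `(1 + ‖x‖)^K ≤ (max 2 (2 max(ω₂⁻¹, 1)))^K (1 + H(x))^K`. [folklore] -/
theorem one_add_norm_pow_le_pow_mul {ω₂ lam β : ℝ} (hω : 0 < ω₂) (hl : 0 ≤ lam) (hβ : 0 ≤ β)
    (γ : ℝ) (K : ℕ) (x : PhaseSpace N) :
    (1 + ‖x‖) ^ K ≤
      (max 2 (2 * max ω₂⁻¹ 1)) ^ K * (1 + (pinnedChain ω₂ lam β γ).hamiltonian N x) ^ K := by
  rw [← mul_pow]
  exact pow_le_pow_left₀ (by positivity) (one_add_norm_le_mul_one_add_hamiltonian hω hl hβ γ x) K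

/-- **Polynomial weights are exponentially dominated**: `(1 + ‖x‖)^K ≤ A e^{ϑ H(x)}` for every
`ϑ > 0`, with `A = A(ω₂, ϑ, K) > 0`. [folklore] -/
theorem one_add_norm_pow_le_exp_hamiltonian {ω₂ lam β : ℝ} (hω : 0 < ω₂) (hl : 0 ≤ lam)
    (hβ : 0 ≤ β) (γ : ℝ) (N : ℕ) {ϑ : ℝ} (hϑ : 0 < ϑ) (K : ℕ) :
    ∃ A : ℝ, 0 < A ∧ ∀ x : PhaseSpace N,
      (1 + ‖x‖) ^ K ≤ A * Real.exp (ϑ * (pinnedChain ω₂ lam β γ).hamiltonian N x) := by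
  refine ⟨(max 2 (2 * max ω₂⁻¹ 1)) ^ K * (K.factorial / ϑ ^ K * Real.exp ϑ), by positivity,
    fun x => ?_⟩
  have hH := pinnedChain_hamiltonian_nonneg hω.le hl hβ γ N x
  calc (1 + ‖x‖) ^ K
      ≤ (max 2 (2 * max ω₂⁻¹ 1)) ^ K * (1 + (pinnedChain ω₂ lam β γ).hamiltonian N x) ^ K :=
        one_add_norm_pow_le_pow_mul hω hl hβ γ K x
    _ ≤ (max 2 (2 * max ω₂⁻¹ 1)) ^ K * ((K.factorial / ϑ ^ K * Real.exp ϑ) *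
          Real.exp (ϑ * (pinnedChain ω₂ lam β γ).hamiltonian N x)) :=
        mul_le_mul_of_nonneg_left (one_add_pow_le_mul_exp K hϑ hH) (by positivity)
    _ = _ := by ring

/-- **Polynomial moments from one exponential moment**: if `e^{ϑH} ∈ L¹(μ)` for some `ϑ > 0` then
`(1 + ‖x‖)^K ∈ L¹(μ)` for every `K`. [folklore] -/
theorem integrable_one_add_norm_pow_of_exp {ω₂ lam β : ℝ} (hω : 0 < ω₂) (hl : 0 ≤ lam) (hβ : 0 ≤ β)
    (γ : ℝ) {μ : Measure (PhaseSpace N)} {ϑ : ℝ} (hϑ : 0 < ϑ)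
    (hint : Integrable (fun x => Real.exp (ϑ * (pinnedChain ω₂ lam β γ).hamiltonian N x)) μ) (K : ℕ) :
    Integrable (fun x : PhaseSpace N => (1 + ‖x‖) ^ K) μ := by
  obtain ⟨A, -, hle⟩ := one_add_norm_pow_le_exp_hamiltonian hω hl hβ γ N hϑ K
  refine (hint.const_mul A).mono' ((continuous_const.add continuous_norm).pow K).aestronglyMeasurable
    (Eventually.of_forall fun x => ?_)
  rw [Real.norm_eq_abs, abs_of_nonneg (by positivity)]
  exact hle x

/-- **Quartic growth of the energy**: `H(x) ≤ (N(1 + |ω₂| + |lam|) + N²(2 + 4|β|)) (1 + ‖x‖)⁴` for the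
pinned chain with ANY real parameters. [folklore] -/
theorem pinnedChain_hamiltonian_le_pow (ω₂ lam β γ : ℝ) (N : ℕ) (x : PhaseSpace N) :
    (pinnedChain ω₂ lam β γ).hamiltonian N x ≤
      ((N : ℝ) * (1 + |ω₂| + |lam|) + (N : ℝ) ^ 2 * (2 + 4 * |β|)) * (1 + ‖x‖) ^ 4 := by
  set s : ℝ := ‖x‖ with hs
  have hs0 : 0 ≤ s := norm_nonneg _
  have h14 : (1 : ℝ) ≤ (1 + s) ^ 4 := one_le_pow₀ (by linarith)
  have hs2 : s ^ 2 ≤ (1 + s) ^ 4 := by nlinarith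
  have hs4 : s ^ 4 ≤ (1 + s) ^ 4 := pow_le_pow_left₀ hs0 (by linarith) 4
  -- on-site terms
  have hsite : ∀ i : Fin N, x.2 i ^ 2 / 2 + (pinnedChain ω₂ lam β γ).U (x.1 i) ≤
      (1 + |ω₂| + |lam|) * (1 + s) ^ 4 := by
    intro i
    obtain ⟨hq, hp⟩ := abs_coord_le_norm x i
    have hp2 : x.2 i ^ 2 ≤ s ^ 2 := by rw [← sq_abs]; exact pow_le_pow_left₀ (abs_nonneg _) hp 2
    have hq2 : x.1 i ^ 2 ≤ s ^ 2 := by rw [← sq_abs]; exact pow_le_pow_left₀ (abs_nonneg _) hq 2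
    have hq4 : x.1 i ^ 4 ≤ s ^ 4 := by
      rw [show x.1 i ^ 4 = |x.1 i| ^ 4 by rw [pow_abs, abs_of_nonneg (by positivity)]]
      exact pow_le_pow_left₀ (abs_nonneg _) hq 4
    have hU : (pinnedChain ω₂ lam β γ).U (x.1 i) = ω₂ * x.1 i ^ 2 / 2 + lam * x.1 i ^ 4 / 4 := rfl
    rw [hU]
    have e1 : ω₂ * x.1 i ^ 2 ≤ |ω₂| * s ^ 2 :=
      (mul_le_mul_of_nonneg_right (le_abs_self ω₂) (sq_nonneg _)).trans
        (mul_le_mul_of_nonneg_left hq2 (abs_nonneg _))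
    have e2 : lam * x.1 i ^ 4 ≤ |lam| * s ^ 4 :=
      (mul_le_mul_of_nonneg_right (le_abs_self lam) (by positivity)).trans
        (mul_le_mul_of_nonneg_left hq4 (abs_nonneg _))
    have e3 : |ω₂| * s ^ 2 ≤ |ω₂| * (1 + s) ^ 4 := mul_le_mul_of_nonneg_left hs2 (abs_nonneg _)
    have e4 : |lam| * s ^ 4 ≤ |lam| * (1 + s) ^ 4 := mul_le_mul_of_nonneg_left hs4 (abs_nonneg _)
    have e5 : 0 ≤ |ω₂| * (1 + s) ^ 4 := by positivity
    have e6 : 0 ≤ |lam| * (1 + s) ^ 4 := by positivity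
    linarith
  -- bond terms
  have hbond : ∀ i j : Fin N, (if j.val = i.val + 1 then (pinnedChain ω₂ lam β γ).V (x.1 j - x.1 i) else 0) ≤
      (2 + 4 * |β|) * (1 + s) ^ 4 := by
    intro i j
    split_ifs
    · set r := x.1 j - x.1 i with hr
      have hra : |r| ≤ 2 * s := by
        obtain ⟨hqi, -⟩ := abs_coord_le_norm x i
        obtain ⟨hqj, -⟩ := abs_coord_le_norm x j
        calc |r| ≤ |x.1 j| + |x.1 i| := abs_sub _ _
          _ ≤ 2 * s := by linarith
      have hr2 : r ^ 2 ≤ 4 * s ^ 2 := by nlinarith [abs_nonneg r, sq_abs r]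
      have hr4 : r ^ 4 ≤ 16 * s ^ 4 := by nlinarith [hr2, sq_nonneg r]
      have hV : (pinnedChain ω₂ lam β γ).V r = r ^ 2 / 2 + β * r ^ 4 / 4 := rfl
      rw [hV]
      have e2 : β * r ^ 4 ≤ |β| * (16 * s ^ 4) :=
        (mul_le_mul_of_nonneg_right (le_abs_self β) (by positivity)).trans
          (mul_le_mul_of_nonneg_left hr4 (abs_nonneg _))
      have e3 : |β| * (16 * s ^ 4) ≤ |β| * (16 * (1 + s) ^ 4) :=
        mul_le_mul_of_nonneg_left (by linarith) (abs_nonneg _)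
      nlinarith
    · positivity
  unfold OscillatorChain.hamiltonian
  calc (∑ i, (x.2 i ^ 2 / 2 + (pinnedChain ω₂ lam β γ).U (x.1 i))) +
        ∑ i : Fin N, ∑ j : Fin N,
          (if j.val = i.val + 1 then (pinnedChain ω₂ lam β γ).V (x.1 j - x.1 i) else 0)
      ≤ (∑ _i : Fin N, (1 + |ω₂| + |lam|) * (1 + s) ^ 4) +
          ∑ _i : Fin N, ∑ _j : Fin N, (2 + 4 * |β|) * (1 + s) ^ 4 :=
        add_le_add (Finset.sum_le_sum fun i _ => hsite i)
          (Finset.sum_le_sum fun i _ => Finset.sum_le_sum fun j _ => hbond i j)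
    _ = _ := by
        simp only [Finset.sum_const, Finset.card_univ, Fintype.card_fin, nsmul_eq_mul]
        ring

/-! ## (a4) Equal mean bond currents on all genuine bonds -/

/-- **Local energy balance in a weak steady state, every interior site**: for the pinned chain with
`ω₂, lam, β ≥ 0` (any `γ`), a weak steady state `μ` (any bath temperatures) with all polynomial moments, and
sites `m = i + 1` with `m + 2 ≤ N` (so `1 ≤ m ≤ N - 2`): `∫ j_i dμ = ∫ j_m dμ`. Weak stationarity on
the smooth, quartically bounded site energy `h_m` (independent of `p_0, p_{N-1}`, so the bath terms of
the generator vanish and `L h_m = X_H h_m = j_i - j_m`). [cite: BonettoLebowitzReyBellet2000, §5.2 eqs. (25)–(27)] -/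
theorem integral_bondCurrent_eq_succ_of_isSteadyState {ω₂ lam β : ℝ} (hω : 0 ≤ ω₂) (hl : 0 ≤ lam)
    (hβ : 0 ≤ β) (γ T_L T_R : ℝ) {μ : Measure (PhaseSpace N)} (hμ : (pinnedChain ω₂ lam β γ).IsSteadyState N T_L T_R μ)
    (hmom : ∀ K : ℕ, Integrable (fun x : PhaseSpace N => (1 + ‖x‖) ^ K) μ)
    (i m : Fin N) (him : m.val = i.val + 1) (hm : m.val + 2 ≤ N) :
    ∫ x, (pinnedChain ω₂ lam β γ).bondCurrent N i x ∂μ =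
      ∫ x, (pinnedChain ω₂ lam β γ).bondCurrent N m x ∂μ := by
  set P := pinnedChain ω₂ lam β γ with hP
  haveI := hμ.1
  have hU : ContDiff ℝ ∞ P.U := pinnedChain_contDiff_U ω₂ lam β γ
  have hV : ContDiff ℝ ∞ P.V := pinnedChain_contDiff_V ω₂ lam β γ
  have hUd : Differentiable ℝ P.U := hU.differentiable (by simp)
  have hVd : Differentiable ℝ P.V := hV.differentiable (by simp)
  -- the site energy at `m`
  set e : PhaseSpace N → ℝ := fun x =>
    (∑ k : Fin N, (if k = m then (1 : ℝ) else 0) * (x.2 k ^ 2 / 2 + P.U (x.1 k))) +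
      ∑ k : Fin N, ∑ l : Fin N,
        if l.val = k.val + 1 then ((if k = m then (1 : ℝ) else 0) + (if l = m then (1 : ℝ) else 0)) / 2 *
          P.V (x.1 l - x.1 k) else 0 with he
  have hes : ContDiff ℝ ∞ e := by
    refine (ContDiff.sum fun k _ => contDiff_const.mul ((((contDiff_apply ℝ ℝ k).comp contDiff_snd).pow 2
      |>.div_const 2).add (hU.comp ((contDiff_apply ℝ ℝ k).comp contDiff_fst)))).add
      (ContDiff.sum fun k _ => ContDiff.sum fun l _ => ?_)
    split_ifs <;> first
      | exact contDiff_const.mul (hV.comp (((contDiff_apply ℝ ℝ l).comp contDiff_fst).sub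
          ((contDiff_apply ℝ ℝ k).comp contDiff_fst)))
      | exact contDiff_const
  -- `X_H h_m = j_i - j_m`, and the bath derivatives of `h_m` vanish
  have hLe : ∀ x, liouvilleOp P N e x = P.bondCurrent N i x - P.bondCurrent N m x :=
    fun x => liouvilleOp_siteEnergy P m e he hUd hVd him x
  have hde : ∀ b : Fin N, b ≠ m → partialP b e = fun _ => 0 := fun b hb =>
    partialP_siteEnergy_of_ne P m e he hb
  have hbath : ∀ b : Fin N, b.val = 0 ∨ b.val = N - 1 → partialP b e = fun _ => 0 := by
    intro b hb
    refine hde b fun hbm => ?_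
    subst hbm
    omega
  have hgen : ∀ x, P.generator N T_L T_R e x = P.bondCurrent N i x - P.bondCurrent N m x := by
    intro x
    rw [← hLe x]
    unfold OscillatorChain.generator liouvilleOp
    have hsum : ∑ b : Fin N,
        ((if b.val = 0 then T_L * partialP b (partialP b e) x - x.2 b * partialP b e x else 0) +
          (if b.val = N - 1 then T_R * partialP b (partialP b e) x - x.2 b * partialP b e x else 0)) = 0 := by
      refine Finset.sum_eq_zero fun b _ => ?_
      by_cases hb : b.val = 0 ∨ b.val = N - 1
      · have hpe : partialP b e = fun _ => 0 := hbath b hb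
        have hp0 : partialP b (fun _ : PhaseSpace N => (0 : ℝ)) x = 0 := by simp [partialP]
        simp [hpe, hp0]
      · push Not at hb
        simp [hb.1, hb.2]
    rw [hsum, mul_zero, add_zero]
  have h0 : ∀ b : Fin N, b.val = 0 → ∀ x, partialP b e x = 0 := fun b hb x => by
    rw [hbath b (Or.inl hb)]
  have h1 : ∀ b : Fin N, b.val = N - 1 → ∀ x, partialP b e x = 0 := fun b hb x => by
    rw [hbath b (Or.inr hb)]
  -- growth bounds: `0 ≤ h_m ≤ H ≤ C_N (1 + ‖x‖)⁴`, `|j_i - j_m| ≤ 2(2 + 8|β|)(1 + ‖x‖)⁴`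
  have hU0 : ∀ q, 0 ≤ P.U q := fun q => by
    show 0 ≤ ω₂ * q ^ 2 / 2 + lam * q ^ 4 / 4
    positivity
  have hV0 : ∀ r, 0 ≤ P.V r := fun r => by
    show 0 ≤ r ^ 2 / 2 + β * r ^ 4 / 4
    positivity
  set C_N : ℝ := (N : ℝ) * (1 + |ω₂| + |lam|) + (N : ℝ) ^ 2 * (2 + 4 * |β|) with hC_N
  set C : ℝ := max C_N (2 * (2 + 8 * |β|)) with hC
  have hwb : ∀ x, |e x| ≤ C * (1 + ‖x‖) ^ 4 := by
    intro x
    rw [abs_of_nonneg (siteEnergy_nonneg P m e he hU0 hV0 x)]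
    calc e x ≤ P.hamiltonian N x := siteEnergy_le_hamiltonian P m e he hU0 hV0 x
      _ ≤ C_N * (1 + ‖x‖) ^ 4 := pinnedChain_hamiltonian_le_pow ω₂ lam β γ N x
      _ ≤ C * (1 + ‖x‖) ^ 4 := mul_le_mul_of_nonneg_right (le_max_left _ _) (by positivity)
  have hLwb : ∀ x, |P.generator N T_L T_R e x| ≤ C * (1 + ‖x‖) ^ 4 := by
    intro x
    rw [hgen x]
    have a1 := pinnedChain_abs_bondCurrent_le_pow ω₂ lam β γ x i
    have a2 := pinnedChain_abs_bondCurrent_le_pow ω₂ lam β γ x m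
    calc _ ≤ _ := abs_sub _ _
      _ ≤ 2 * (2 + 8 * |β|) * (1 + ‖x‖) ^ 4 := by linarith
      _ ≤ C * (1 + ‖x‖) ^ 4 := mul_le_mul_of_nonneg_right (le_max_right _ _) (by positivity)
  have hzero := integral_generator_eq_zero_of_polyGrowth P hU hV T_L T_R
    (fun b x => pinnedChain_abs_partialQ_hamiltonian_le ω₂ lam β γ x b) μ hμ.2.1 hmom hes h0 h1 hwb hLwb
  simp only [hgen] at hzero
  rw [integral_sub (hμ.2.2 _) (hμ.2.2 _)] at hzero
  linarith

/-- **(a4), measure-level form: all genuine bond currents have the same mean** in a weak steady state of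
the pinned chain (`ω₂, lam, β ≥ 0`, any `γ`, any bath temperatures) with all polynomial moments:
`∫ j_i dμ = ∫ j_k dμ` whenever `i + 2 ≤ N`, `k + 2 ≤ N`. [folklore] -/
theorem integral_bondCurrent_eq_of_isSteadyState {ω₂ lam β : ℝ} (hω : 0 ≤ ω₂) (hl : 0 ≤ lam)
    (hβ : 0 ≤ β) (γ T_L T_R : ℝ)
    {μ : Measure (PhaseSpace N)} (hμ : (pinnedChain ω₂ lam β γ).IsSteadyState N T_L T_R μ)
    (hmom : ∀ K : ℕ, Integrable (fun x : PhaseSpace N => (1 + ‖x‖) ^ K) μ)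
    (i k : Fin N) (hi : i.val + 2 ≤ N) (hk : k.val + 2 ≤ N) :
    ∫ x, (pinnedChain ω₂ lam β γ).bondCurrent N i x ∂μ =
      ∫ x, (pinnedChain ω₂ lam β γ).bondCurrent N k x ∂μ := by
  -- every genuine bond current has the mean of `j_0`
  have key : ∀ (d : ℕ) (j : Fin N), j.val = d → j.val + 2 ≤ N →
      ∫ x, (pinnedChain ω₂ lam β γ).bondCurrent N j x ∂μ =
        ∫ x, (pinnedChain ω₂ lam β γ).bondCurrent N ⟨0, by omega⟩ x ∂μ := by
    intro d
    induction d with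
    | zero =>
      intro j hj hj2
      have : j = ⟨0, by omega⟩ := Fin.ext hj
      rw [this]
    | succ d ih =>
      intro j hj hj2
      have h := integral_bondCurrent_eq_succ_of_isSteadyState hω hl hβ γ T_L T_R hμ hmom
        ⟨d, by omega⟩ j (by simp [hj]) hj2
      rw [← h]
      exact ih ⟨d, by omega⟩ rfl (by simp; omega)
  rw [key i.val i rfl hi, key k.val k rfl hk]

/-- **(a4) along a steady-state family**: for the pinned chain (all parameters `> 0`), under weak-NESS
uniqueness, along a steady-state family `μ`, for `N ≥ 2` and all bath temperatures `T_L, T_R > 0`,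
all genuine bond currents have the same mean in `μ N T_L T_R` (polynomial moments from the exponential
moment of `BondHeatUncertainty.ness_facts`). [folklore] -/
theorem steadyFamily_integral_bondCurrent_eq :
    ∀ ω₂ lam β γ : ℝ, 0 < ω₂ → 0 < lam → 0 < β → 0 < γ →
    (∀ (N : ℕ) (T_L T_R : ℝ), 0 < T_L → 0 < T_R → ∀ μ ν : Measure (PhaseSpace N),
      (pinnedChain ω₂ lam β γ).IsSteadyState N T_L T_R μ →
      (pinnedChain ω₂ lam β γ).IsSteadyState N T_L T_R ν → μ = ν) →
    ∀ μ : (N : ℕ) → ℝ → ℝ → Measure (PhaseSpace N),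
    (∀ (N : ℕ) (T_L T_R : ℝ), 0 < T_L → 0 < T_R →
      (pinnedChain ω₂ lam β γ).IsSteadyState N T_L T_R (μ N T_L T_R)) →
    ∀ N : ℕ, 2 ≤ N → ∀ (T_L T_R : ℝ), 0 < T_L → 0 < T_R → ∀ i k : Fin N, i.val + 2 ≤ N → k.val + 2 ≤ N →
      ∫ x, (pinnedChain ω₂ lam β γ).bondCurrent N i x ∂(μ N T_L T_R) =
        ∫ x, (pinnedChain ω₂ lam β γ).bondCurrent N k x ∂(μ N T_L T_R) := by
  intro ω₂ lam β γ hω hl hβ hγ hU μ hμ N hN T_L T_R hL hR i k hi hk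
  obtain ⟨-, -, hint, -⟩ :=
    Summit.AtomisticToContinuum.FouriersLaw.Theorems.BondHeatUncertainty.ness_facts ω₂ lam β γ hω hl hβ hγ
      hU μ hμ N hN T_L T_R hL hR
  have hmax : 0 < max T_L T_R := lt_max_of_lt_left hL
  have hϑ0 : 0 < 1 / max T_L T_R / 2 := by positivity
  have hϑ1 : 1 / max T_L T_R / 2 < 1 / max T_L T_R := half_lt_self (by positivity)
  exact integral_bondCurrent_eq_of_isSteadyState hω.le hl.le hβ.le γ T_L T_R (hμ N T_L T_R hL hR)
    (integrable_one_add_norm_pow_of_exp hω hl.le hβ.le γ hϑ0 (hint _ hϑ0 hϑ1)) i k hi hk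

end Summit.AtomisticToContinuum.FouriersLaw.Theorems.LocalOhmBirth

end
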